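import Summits.CriticalPhenomena.PercolationContinuityZ3.Theorems.PercNearOneGluingNoHeavyPcintBSMLocal
import HarnessLib

/-!
# PCINT lane, PHASE 5 (block-renewal second moment): fast shared-key counts for `t = 3`

Cell `prim-pcint`, seat `prim-pcint-1` (gen 14); memo `run/shared/lean/prim/pcint/T-FIBRE-ROUTE.md` §PHASE 5.

The shared transverse key count `BSM.S` compares edge keys whose vertices are functions `Fin 3 → ℤ`; deciding equality
of such functions is slow in the kernel.  `BSM.S3` is the same Finset cardinality with vertices transported to
`ℤ × ℤ × ℤ` along the injection `BSM.tr3` (**`BSM.S_eq_S3`**), so the kernel compares integer triples instead.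
-/

namespace Summit.CriticalPhenomena.PercolationContinuityZ3.Theorems.Pcint.BSM

open Finset

variable {k np : ℕ}

/-- Coordinates of a vector of `ℤ^3` as a triple. -/
def tr3 (v : Fin 3 → ℤ) : ℤ × ℤ × ℤ := (v 0, v 1, v 2)

/-- `tr3` is injective. -/
theorem tr3_injective : Function.Injective tr3 := by
  intro v w h
  simp only [tr3, Prod.mk.injEq] at h
  funext i
  fin_cases i
  · exact h.1
  · exact h.2.1
  · exact h.2.2

/-- `tr3` is additive. -/
theorem tr3_add (v w : Fin 3 → ℤ) : tr3 (v + w) = tr3 v + tr3 w := rfl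

/-- Keys with triple vertices. -/
abbrev LKey3 (k : ℕ) := (ℤ × ℤ × ℤ) × (Fin 3 ⊕ Fin k)

/-- Transport of edge keys to triple vertices. -/
def embK3 (k : ℕ) : LKey 3 k ↪ LKey3 k :=
  ⟨fun q => (tr3 q.1, q.2), fun q q' h => by
    simp only [Prod.mk.injEq] at h
    exact Prod.ext (tr3_injective h.1) h.2⟩

/-- The step vector of a signed axis as a triple. -/
def sv3 (q : Fin 3 × Bool) : ℤ × ℤ × ℤ := tr3 (sv q)

/-- The transverse edge keys of a piece started at the triple `u` (mirror of `BSM.tedges`). -/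
def tedges3 (k : ℕ) : ℤ × ℤ × ℤ → List (Fin 3 × Bool) → Finset (LKey3 k)
  | _, [] => ∅
  | u, q :: σ => insert (if q.2 then (u, Sum.inl q.1) else (u + sv3 q, Sum.inl q.1)) (tedges3 k (u + sv3 q) σ)

/-- `tedges3` is the transport of `tedges`. -/
theorem tedges_map_embK3 (k : ℕ) : ∀ (u : Fin 3 → ℤ) (σ : List (Fin 3 × Bool)),
    (tedges k u σ).map (embK3 k) = tedges3 k (tr3 u) σ
  | u, [] => by simp [tedges, tedges3]
  | u, q :: σ => by
    rw [tedges, tedges3, Finset.map_insert, tedges_map_embK3 k (u + sv q) σ, tr3_add]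
    congr 1
    split_ifs <;> rfl

/-- Shift of triple keys. -/
def shiftE3 (k : ℕ) (y : ℤ × ℤ × ℤ) : LKey3 k ↪ LKey3 k :=
  ⟨fun q => (q.1 + y, q.2), fun q q' h => by
    simp only [Prod.mk.injEq, add_left_inj] at h
    exact Prod.ext h.1 h.2⟩

/-- Transport commutes with shifting. -/
theorem shiftE_trans_embK3 (k : ℕ) (y : Fin 3 → ℤ) :
    (shiftE (k := k) y).trans (embK3 k) = (embK3 k).trans (shiftE3 k (tr3 y)) := by
  ext q <;> simp [shiftE, embK3, shiftE3, tr3_add, Function.Embedding.trans]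

/-- **The fast shared transverse key count** (integer-triple vertices). -/
def S3 (pc : Fin np → List (Fin 3 × Bool)) (k : ℕ) (y : Fin 3 → ℤ) (σ σ' : Fin np) : ℕ :=
  (tedges3 k (0, 0, 0) (pc σ) ∩ (tedges3 k (0, 0, 0) (pc σ')).map (shiftE3 k (tr3 y))).card

/-- **`S = S3`.** -/
theorem S_eq_S3 (pc : Fin np → List (Fin 3 × Bool)) (k : ℕ) (y : Fin 3 → ℤ) (σ σ' : Fin np) :
    S pc k y σ σ' = S3 pc k y σ σ' := by
  unfold S S3
  rw [← Finset.card_map (embK3 k), Finset.map_inter, Finset.map_map, shiftE_trans_embK3, ← Finset.map_map,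
    tedges_map_embK3, tedges_map_embK3]
  rfl

end Summit.CriticalPhenomena.PercolationContinuityZ3.Theorems.Pcint.BSM
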